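import Mathlib.Analysis.Calculus.MeanValue
import Mathlib.Analysis.Calculus.Deriv.Add
import Mathlib.Analysis.Calculus.Deriv.Pow
import Mathlib.Analysis.Calculus.Deriv.Comp
import Mathlib.Analysis.Calculus.Deriv.Mul
import Mathlib.Analysis.Calculus.Deriv.Slope
import Mathlib.Analysis.Calculus.Deriv.MeanValue
import Mathlib.Analysis.Calculus.LocalExtr.Basic
import HarnessLib

/-!
# One-sided calculus at a joint touching point (card v5.2 P2 of the netflux line on crux `PoloidalLiouville`,
# stmt-NavierStokesRegularity-1222, W1): the brick between NF-1cᵛ/NF-6 and `HalfLineOU.halfLineOU_decay_viscosity`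

Support file for crux `PoloidalLiouville` (line «netflux-typei-gap» v5 = VISCOSITY of planner ns-idea-14; contract P2 of card
v5.2, `Cruxes/PoloidalLiouville/Lines/netflux_typei_gap.md` 2af6c0ec0655).  ARM A `pub/ns-exp-scalarLiouville` g3.  Pure one-variable
calculus; nothing about Navier–Stokes.

`NetFlux.touching_oneSided_of_jointLocalMax`: if `(s₀,ρ₀)` is a local maximum of `(s,ρ) ↦ U s ρ − φ s ρ`, the test function `φ`
has `∂ₛφ(s₀,ρ₀) = φₛ`, `φ(s₀,·)` has derivative `φ₁` everywhere and `φ₁` has derivative `φ₂` everywhere (exactly the test class of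
`HalfLineOU.halfLineOU_decay_viscosity`, p663208), and `U(s₀,·)` has derivative `w₀` at `ρ₀`, then
(i) FERMAT in `ρ`: `φ₁ ρ₀ = w₀`;
(ii) SECOND SYMMETRIC DIFFERENCES: for every `ε > 0`, eventually as `k ↓ 0`,
     `(U s₀ (ρ₀+k) − 2U s₀ ρ₀ + U s₀ (ρ₀−k))/k² ≤ φ₂ ρ₀ + ε` (touching from above + Taylor–Peano for `φ(s₀,·)` at `ρ₀`);
(iii) PAST DIFFERENCE QUOTIENTS in `s`: for every `ε > 0`, eventually as `σ ↓ 0`, `φₛ − ε ≤ (U s₀ ρ₀ − U (s₀−σ) ρ₀)/σ`.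
These are the three one-sided steps by which the one-sided law (L) `OneSidedNetFluxLaw` + (NC) `NearCentreFlux` deliver the
viscosity inequality consumed by NF-3ᵛ.
-/

-- the summit and its single problem share the name (D-0017 nested layout)
set_option linter.dupNamespace false

noncomputable section

open Set Filter Topology Asymptotics

namespace Summit.NavierStokesRegularity.NavierStokesRegularity.Theorems.PoloidalLiouville.NetFlux

/-- Restriction of a joint local maximum to the horizontal and vertical lines through the point. -/
theorem isLocalMax_slices {F : ℝ × ℝ → ℝ} {s₀ ρ₀ : ℝ} (hmax : IsLocalMax F (s₀, ρ₀)) :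
    IsLocalMax (fun r => F (s₀, r)) ρ₀ ∧ IsLocalMax (fun s => F (s, ρ₀)) s₀ := by
  constructor
  · have hc : Tendsto (fun r : ℝ => (s₀, r)) (𝓝 ρ₀) (𝓝 (s₀, ρ₀)) :=
      (continuous_const.prodMk continuous_id).tendsto' ρ₀ (s₀, ρ₀) rfl
    exact hc.eventually hmax
  · have hc : Tendsto (fun s : ℝ => (s, ρ₀)) (𝓝 s₀) (𝓝 (s₀, ρ₀)) :=
      (continuous_id.prodMk continuous_const).tendsto' s₀ (s₀, ρ₀) rfl
    exact hc.eventually hmax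

/-- **Taylor–Peano at order two from pointwise data**: if `g` has derivative `g₁ r` at every `r` and `g₁` has derivative `g₂`
at `ρ₀`, then for every `ε > 0`, for `k > 0` small, `|g(ρ₀+k) + g(ρ₀−k) − 2g(ρ₀) − k²g₂| ≤ ε k²`. -/
theorem secondDifference_le {g g₁ : ℝ → ℝ} {g₂ ρ₀ : ℝ} (hg : ∀ r, HasDerivAt g (g₁ r) r) (hg₁ : HasDerivAt g₁ g₂ ρ₀) :
    ∀ ε > 0, ∀ᶠ k in 𝓝[>] (0 : ℝ), |g (ρ₀ + k) + g (ρ₀ - k) - 2 * g ρ₀ - k ^ 2 * g₂| ≤ ε * k ^ 2 := by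
  intro ε hε
  -- `g₁ r − g₁ ρ₀ − g₂ (r − ρ₀) = o(r − ρ₀)`
  have hlo : ∀ᶠ r in 𝓝 ρ₀, |g₁ r - g₁ ρ₀ - (r - ρ₀) * g₂| ≤ (ε / 2) * |r - ρ₀| := by
    have h := hg₁.isLittleO
    rw [Asymptotics.isLittleO_iff] at h
    have h' := h (half_pos hε)
    filter_upwards [h'] with r hr
    simpa [Real.norm_eq_abs, smul_eq_mul, mul_comm] using hr
  -- a ball around `ρ₀` on which it holds
  obtain ⟨δ, hδ, hball⟩ := Metric.eventually_nhds_iff.1 hlo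
  have hk : ∀ᶠ k in 𝓝[>] (0 : ℝ), k < δ := by
    have : Iio δ ∈ 𝓝 (0 : ℝ) := Iio_mem_nhds hδ
    exact mem_nhdsWithin_of_mem_nhds this
  have hk0 : ∀ᶠ k in 𝓝[>] (0 : ℝ), 0 < k := self_mem_nhdsWithin
  filter_upwards [hk, hk0] with k hkδ hkpos
  -- the remainder `h(r) = g r − g ρ₀ − g₁ ρ₀ (r − ρ₀) − g₂ (r − ρ₀)²/2`
  set h : ℝ → ℝ := fun r => g r - g ρ₀ - g₁ ρ₀ * (r - ρ₀) - g₂ * (r - ρ₀) ^ 2 / 2 with hh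
  have hh0 : h ρ₀ = 0 := by simp [hh]
  have hhd : ∀ r, HasDerivAt h (g₁ r - g₁ ρ₀ - (r - ρ₀) * g₂) r := by
    intro r
    have hsub : HasDerivAt (fun x : ℝ => x - ρ₀) 1 r := (hasDerivAt_id r).sub_const ρ₀
    have h1 : HasDerivAt (fun r => g₁ ρ₀ * (r - ρ₀)) (g₁ ρ₀ * 1) r := HasDerivAt.const_mul (g₁ ρ₀) hsub
    have h2 : HasDerivAt (fun r => g₂ * (r - ρ₀) ^ 2 / 2) (g₂ * (r - ρ₀)) r := by
      have h0 : HasDerivAt (fun x : ℝ => (x - ρ₀) ^ 2) (((2 : ℕ) : ℝ) * (r - ρ₀) ^ (2 - 1) * 1) r :=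
        hsub.pow 2
      have h3 := (HasDerivAt.const_mul g₂ h0).div_const 2
      refine h3.congr_deriv ?_
      push_cast; ring
    have h4 := ((HasDerivAt.sub_const (g ρ₀) (hg r)).sub h1).sub h2
    refine h4.congr_deriv ?_
    ring
  -- mean value inequality on `[ρ₀ − k, ρ₀ + k]` with the bound `ε/2 · k`
  have hseg : ∀ r ∈ Icc (ρ₀ - k) (ρ₀ + k), ‖g₁ r - g₁ ρ₀ - (r - ρ₀) * g₂‖ ≤ ε / 2 * k := by
    intro r hr
    have hrball : dist r ρ₀ < δ := by
      rw [Real.dist_eq, abs_lt]; constructor <;> linarith [hr.1, hr.2]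
    have h1 := hball hrball
    have h2 : |r - ρ₀| ≤ k := abs_le.2 ⟨by linarith [hr.1], by linarith [hr.2]⟩
    rw [Real.norm_eq_abs]
    calc |g₁ r - g₁ ρ₀ - (r - ρ₀) * g₂| ≤ ε / 2 * |r - ρ₀| := h1
      _ ≤ ε / 2 * k := by gcongr
  have hconv : Convex ℝ (Icc (ρ₀ - k) (ρ₀ + k)) := convex_Icc _ _
  have hρ₀mem : ρ₀ ∈ Icc (ρ₀ - k) (ρ₀ + k) := ⟨by linarith, by linarith⟩
  have hmvt : ∀ r ∈ Icc (ρ₀ - k) (ρ₀ + k), ‖h r - h ρ₀‖ ≤ ε / 2 * k * ‖r - ρ₀‖ := fun r hr =>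
    hconv.norm_image_sub_le_of_norm_hasDerivWithin_le (fun x _ => (hhd x).hasDerivWithinAt) hseg hρ₀mem hr
  have hp := hmvt (ρ₀ + k) ⟨by linarith, le_rfl⟩
  have hm := hmvt (ρ₀ - k) ⟨le_rfl, by linarith⟩
  rw [hh0, sub_zero, Real.norm_eq_abs, Real.norm_eq_abs] at hp hm
  rw [show ρ₀ + k - ρ₀ = k by ring, abs_of_pos hkpos] at hp
  rw [show ρ₀ - k - ρ₀ = -k by ring, abs_neg, abs_of_pos hkpos] at hm
  -- `g(ρ₀+k) + g(ρ₀−k) − 2g(ρ₀) − k² g₂ = h(ρ₀+k) + h(ρ₀−k)`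
  have hsum : g (ρ₀ + k) + g (ρ₀ - k) - 2 * g ρ₀ - k ^ 2 * g₂ = h (ρ₀ + k) + h (ρ₀ - k) := by
    simp only [hh]; ring
  rw [hsum]
  calc |h (ρ₀ + k) + h (ρ₀ - k)| ≤ |h (ρ₀ + k)| + |h (ρ₀ - k)| := abs_add_le _ _
    _ ≤ ε / 2 * k * k + ε / 2 * k * k := add_le_add hp hm
    _ = ε * k ^ 2 := by ring

/-- **P2 brick (card v5.2 of the netflux line): one-sided relations at a joint touching point.**  See the module docstring:
(i) Fermat in `ρ`, (ii) upper bound for the second symmetric differences of `U(s₀,·)` by `φ₂ ρ₀ + ε`, (iii) lower bound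
`φₛ − ε` for the past difference quotients of `U(·,ρ₀)`; binders = the test class of `HalfLineOU.halfLineOU_decay_viscosity`
plus `HasDerivAt (U s₀) w₀ ρ₀`. -/
theorem touching_oneSided_of_jointLocalMax (U φ : ℝ → ℝ → ℝ) (φₛ w₀ : ℝ) (φ₁ φ₂ : ℝ → ℝ) (s₀ ρ₀ : ℝ)
    (hmax : IsLocalMax (fun p : ℝ × ℝ => U p.1 p.2 - φ p.1 p.2) (s₀, ρ₀))
    (hφs : HasDerivAt (fun σ => φ σ ρ₀) φₛ s₀)
    (hφ1 : ∀ r, HasDerivAt (φ s₀) (φ₁ r) r) (hφ2 : ∀ r, HasDerivAt φ₁ (φ₂ r) r)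
    (hU : HasDerivAt (U s₀) w₀ ρ₀) :
    φ₁ ρ₀ = w₀ ∧
    (∀ ε > 0, ∀ᶠ k in 𝓝[>] (0 : ℝ),
        (U s₀ (ρ₀ + k) - 2 * U s₀ ρ₀ + U s₀ (ρ₀ - k)) / k ^ 2 ≤ φ₂ ρ₀ + ε) ∧
    (∀ ε > 0, ∀ᶠ σ in 𝓝[>] (0 : ℝ), φₛ - ε ≤ (U s₀ ρ₀ - U (s₀ - σ) ρ₀) / σ) := by
  obtain ⟨hmaxρ, hmaxs⟩ := isLocalMax_slices (F := fun p : ℝ × ℝ => U p.1 p.2 - φ p.1 p.2) hmax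
  -- the slices, as named functions
  have hmaxρ' : IsLocalMax (fun r => U s₀ r - φ s₀ r) ρ₀ := hmaxρ
  have hmaxs' : IsLocalMax (fun s => U s ρ₀ - φ s ρ₀) s₀ := hmaxs
  refine ⟨?_, ?_, ?_⟩
  · -- (i) Fermat
    have hd : HasDerivAt (fun r => U s₀ r - φ s₀ r) (w₀ - φ₁ ρ₀) ρ₀ := hU.sub (hφ1 ρ₀)
    have h0 := hmaxρ'.hasDerivAt_eq_zero hd
    linarith
  · -- (ii) second symmetric differences
    intro ε hε
    obtain ⟨δ, hδ, hball⟩ := Metric.eventually_nhds_iff.1 hmaxρ'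
    have hk : ∀ᶠ k in 𝓝[>] (0 : ℝ), k < δ :=
      mem_nhdsWithin_of_mem_nhds (Iio_mem_nhds hδ)
    have hk0 : ∀ᶠ k in 𝓝[>] (0 : ℝ), 0 < k := self_mem_nhdsWithin
    filter_upwards [hk, hk0, secondDifference_le hφ1 (hφ2 ρ₀) ε hε] with k hkδ hkpos htaylor
    have hp : U s₀ (ρ₀ + k) - φ s₀ (ρ₀ + k) ≤ U s₀ ρ₀ - φ s₀ ρ₀ :=
      hball (by rw [Real.dist_eq, show ρ₀ + k - ρ₀ = k by ring, abs_of_pos hkpos]; exact hkδ)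
    have hm : U s₀ (ρ₀ - k) - φ s₀ (ρ₀ - k) ≤ U s₀ ρ₀ - φ s₀ ρ₀ :=
      hball (by rw [Real.dist_eq, show ρ₀ - k - ρ₀ = -k by ring, abs_neg, abs_of_pos hkpos]; exact hkδ)
    have hk2 : 0 < k ^ 2 := by positivity
    rw [div_le_iff₀ hk2]
    have ht := (abs_le.1 htaylor).2
    nlinarith [hp, hm, ht]
  · -- (iii) past difference quotients in `s`
    intro ε hε
    have hlo : ∀ᶠ s in 𝓝 s₀, |φ s ρ₀ - φ s₀ ρ₀ - (s - s₀) * φₛ| ≤ ε * |s - s₀| := by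
      have h := hφs.isLittleO
      rw [Asymptotics.isLittleO_iff] at h
      filter_upwards [h hε] with s hs
      simpa [Real.norm_eq_abs, smul_eq_mul, mul_comm] using hs
    obtain ⟨δ₁, hδ₁, hball₁⟩ := Metric.eventually_nhds_iff.1 hlo
    obtain ⟨δ₂, hδ₂, hball₂⟩ := Metric.eventually_nhds_iff.1 hmaxs'
    have hσ1 : ∀ᶠ σ in 𝓝[>] (0 : ℝ), σ < min δ₁ δ₂ :=
      mem_nhdsWithin_of_mem_nhds (Iio_mem_nhds (lt_min hδ₁ hδ₂))
    have hσ0 : ∀ᶠ σ in 𝓝[>] (0 : ℝ), 0 < σ := self_mem_nhdsWithin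
    filter_upwards [hσ1, hσ0] with σ hσ hσpos
    have hd : dist (s₀ - σ) s₀ = σ := by
      rw [Real.dist_eq, show s₀ - σ - s₀ = -σ by ring, abs_neg, abs_of_pos hσpos]
    have h1 := hball₁ (y := s₀ - σ) (by rw [hd]; exact lt_of_lt_of_le hσ (min_le_left _ _))
    have h2 : U (s₀ - σ) ρ₀ - φ (s₀ - σ) ρ₀ ≤ U s₀ ρ₀ - φ s₀ ρ₀ :=
      hball₂ (y := s₀ - σ) (by rw [hd]; exact lt_of_lt_of_le hσ (min_le_right _ _))
    rw [show s₀ - σ - s₀ = -σ by ring, abs_neg, abs_of_pos hσpos] at h1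
    have h1' := (abs_le.1 h1).2
    rw [le_div_iff₀ hσpos]
    nlinarith [h1', h2]

/-! ### One-sided second-order touching — the form step (WD)(ρ) of the line actually consumes

At a local maximum `x` of `g`, where `g` is differentiable near `x` with derivative `g'` (so `g' x = 0`, Fermat), a ONE-SIDED
derivative `L` of `g'` at `x` — from the right OR from the left — satisfies `L ≤ 0`: otherwise `g' > 0` just right of `x`
(resp. `g' < 0` just left of `x`) and the mean value theorem makes `g` exceed `g x` there.  For the netflux line:
`U(s₀,·) = W(t₀, ·√(−t₀))` is `C¹` with derivative `u(ρ) = √(−t₀)·w(t₀, ρ√(−t₀))`, and `u` has RIGHT derivative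
`(−t₀)·ℓp(t₀,R₀)` at `ρ₀` (`ℓp` = right `r`-derivative of the net flux from `OneSidedNetFluxLaw`); the corollary
`touching_rightDeriv_le_of_jointLocalMax` gives `(−t₀)·ℓp(t₀,R₀) ≤ φ₂ ρ₀`.  NOTE: the symmetric statement (ii) of
`touching_oneSided_of_jointLocalMax` does NOT give this when `ℓm < ℓp` — second symmetric differences of `W = ∫ w` only see
`(ℓp + ℓm)/2`, and for the net flux (semiconvex `ρ·sphSup` minus semiconcave `ρ·sphInf`) one has `ℓm ≤ ℓp`. -/

/-- If `g` has a local maximum at `x`, is differentiable near `x` with derivative `g'`, and `g'` has RIGHT derivative `L`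
at `x`, then `L ≤ 0`. -/
theorem rightDeriv_deriv_nonpos_of_isLocalMax (g g' : ℝ → ℝ) (x L : ℝ) (hmax : IsLocalMax g x)
    (hg : ∀ᶠ y in 𝓝 x, HasDerivAt g (g' y) y) (hL : HasDerivWithinAt g' L (Ioi x) x) : L ≤ 0 := by
  by_contra hpos
  push Not at hpos
  have hg'x : g' x = 0 := hmax.hasDerivAt_eq_zero hg.self_of_nhds
  have hslope : Tendsto (slope g' x) (𝓝[>] x) (𝓝 L) :=
    (hasDerivWithinAt_iff_tendsto_slope' (by simp)).mp hL
  have hev : ∀ᶠ y in 𝓝[>] x, 0 < g' y := by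
    filter_upwards [hslope.eventually_const_lt hpos, self_mem_nhdsWithin] with y hy hyx
    rw [slope_def_field, hg'x, sub_zero] at hy
    exact (div_pos_iff_of_pos_right (sub_pos.mpr hyx)).mp hy
  obtain ⟨ε, hε, hball⟩ := Metric.eventually_nhds_iff.mp (hg.and hmax)
  obtain ⟨u, hu, hsub⟩ := mem_nhdsGT_iff_exists_Ioo_subset.mp hev
  have hxu : x < u := hu
  set b := min (x + ε / 2) ((x + u) / 2) with hb_def
  have hxb : x < b := lt_min (by linarith) (by linarith)
  have hbε : b < x + ε := lt_of_le_of_lt (min_le_left _ _) (by linarith)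
  have hbu : b < u := lt_of_le_of_lt (min_le_right _ _) (by linarith)
  have hder : ∀ z ∈ Icc x b, HasDerivAt g (g' z) z := fun z hz =>
    (hball (by rw [Real.dist_eq, abs_lt]; constructor <;> linarith [hz.1, hz.2])).1
  have hgb : g b ≤ g x := (hball (by rw [Real.dist_eq, abs_lt]; constructor <;> linarith)).2
  obtain ⟨c, hc, hcslope⟩ := exists_hasDerivAt_eq_slope g g' hxb
    (fun z hz => (hder z hz).continuousAt.continuousWithinAt) (fun z hz => hder z (Ioo_subset_Icc_self hz))
  have hcpos : 0 < g' c := hsub ⟨hc.1, lt_trans hc.2 hbu⟩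
  rw [hcslope] at hcpos
  have : 0 < g b - g x := (div_pos_iff_of_pos_right (sub_pos.mpr hxb)).mp hcpos
  linarith

/-- If `g` has a local maximum at `x`, is differentiable near `x` with derivative `g'`, and `g'` has LEFT derivative `L`
at `x`, then `L ≤ 0`. -/
theorem leftDeriv_deriv_nonpos_of_isLocalMax (g g' : ℝ → ℝ) (x L : ℝ) (hmax : IsLocalMax g x)
    (hg : ∀ᶠ y in 𝓝 x, HasDerivAt g (g' y) y) (hL : HasDerivWithinAt g' L (Iio x) x) : L ≤ 0 := by
  by_contra hpos
  push Not at hpos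
  have hg'x : g' x = 0 := hmax.hasDerivAt_eq_zero hg.self_of_nhds
  have hslope : Tendsto (slope g' x) (𝓝[<] x) (𝓝 L) :=
    (hasDerivWithinAt_iff_tendsto_slope' (by simp)).mp hL
  have hev : ∀ᶠ y in 𝓝[<] x, g' y < 0 := by
    filter_upwards [hslope.eventually_const_lt hpos, self_mem_nhdsWithin] with y hy hyx
    rw [slope_def_field, hg'x, sub_zero] at hy
    have hyx' : y - x < 0 := sub_neg.mpr hyx
    have h1 : g' y = g' y / (y - x) * (y - x) := by
      rw [div_mul_cancel₀ _ hyx'.ne]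
    rw [h1]
    exact mul_neg_of_pos_of_neg hy hyx'
  obtain ⟨ε, hε, hball⟩ := Metric.eventually_nhds_iff.mp (hg.and hmax)
  obtain ⟨l, hl, hsub⟩ := mem_nhdsLT_iff_exists_Ioo_subset.mp hev
  have hlx : l < x := hl
  set b := max (x - ε / 2) ((x + l) / 2) with hb_def
  have hbx : b < x := max_lt (by linarith) (by linarith)
  have hbε : x - ε < b := lt_of_lt_of_le (by linarith) (le_max_left _ _)
  have hlb : l < b := lt_of_lt_of_le (by linarith) (le_max_right _ _)
  have hder : ∀ z ∈ Icc b x, HasDerivAt g (g' z) z := fun z hz =>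
    (hball (by rw [Real.dist_eq, abs_lt]; constructor <;> linarith [hz.1, hz.2])).1
  have hgb : g b ≤ g x := (hball (by rw [Real.dist_eq, abs_lt]; constructor <;> linarith)).2
  obtain ⟨c, hc, hcslope⟩ := exists_hasDerivAt_eq_slope g g' hbx
    (fun z hz => (hder z hz).continuousAt.continuousWithinAt) (fun z hz => hder z (Ioo_subset_Icc_self hz))
  have hcneg : g' c < 0 := hsub ⟨lt_trans hlb hc.1, hc.2⟩
  rw [hcslope] at hcneg
  have : g x - g b < 0 := by
    by_contra hnn
    push Not at hnn
    exact absurd hcneg (not_lt.mpr (div_nonneg hnn (sub_pos.mpr hbx).le))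
  linarith

/-- **(WD)(ρ), right form — the one-sided second-order touching inequality.**  If `(s₀,ρ₀)` is a local maximum of
`(s,ρ) ↦ U s ρ − φ s ρ`, `φ(s₀,·)` has derivative `φ₁` and `φ₁` has derivative `φ₂` (test class of
`HalfLineOU.halfLineOU_decay_viscosity`), `U(s₀,·)` is differentiable near `ρ₀` with derivative `u`, and `u` has RIGHT
derivative `L` at `ρ₀`, then `u ρ₀ = φ₁ ρ₀` (Fermat) and `L ≤ φ₂ ρ₀`. -/
theorem touching_rightDeriv_le_of_jointLocalMax (U φ : ℝ → ℝ → ℝ) (u φ₁ φ₂ : ℝ → ℝ) (L s₀ ρ₀ : ℝ)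
    (hmax : IsLocalMax (fun p : ℝ × ℝ => U p.1 p.2 - φ p.1 p.2) (s₀, ρ₀))
    (hφ1 : ∀ r, HasDerivAt (φ s₀) (φ₁ r) r) (hφ2 : ∀ r, HasDerivAt φ₁ (φ₂ r) r)
    (hU : ∀ᶠ ρ in 𝓝 ρ₀, HasDerivAt (U s₀) (u ρ) ρ) (hu : HasDerivWithinAt u L (Ioi ρ₀) ρ₀) :
    u ρ₀ = φ₁ ρ₀ ∧ L ≤ φ₂ ρ₀ := by
  have hρ := (isLocalMax_slices (F := fun p : ℝ × ℝ => U p.1 p.2 - φ p.1 p.2) hmax).1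
  have hg : ∀ᶠ y in 𝓝 ρ₀, HasDerivAt (fun r => U s₀ r - φ s₀ r) (u y - φ₁ y) y := by
    filter_upwards [hU] with y hy using hy.sub (hφ1 y)
  refine ⟨?_, ?_⟩
  · have h0 := hρ.hasDerivAt_eq_zero hg.self_of_nhds
    linarith
  · have hL : HasDerivWithinAt (fun r => u r - φ₁ r) (L - φ₂ ρ₀) (Ioi ρ₀) ρ₀ :=
      hu.sub (hφ2 ρ₀).hasDerivWithinAt
    have h0 := rightDeriv_deriv_nonpos_of_isLocalMax _ _ ρ₀ (L - φ₂ ρ₀) hρ hg hL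
    linarith

/-- **(WD)(ρ), left form.**  Same as `touching_rightDeriv_le_of_jointLocalMax` with a LEFT derivative `L` of `u` at `ρ₀`:
`u ρ₀ = φ₁ ρ₀` and `L ≤ φ₂ ρ₀`. -/
theorem touching_leftDeriv_le_of_jointLocalMax (U φ : ℝ → ℝ → ℝ) (u φ₁ φ₂ : ℝ → ℝ) (L s₀ ρ₀ : ℝ)
    (hmax : IsLocalMax (fun p : ℝ × ℝ => U p.1 p.2 - φ p.1 p.2) (s₀, ρ₀))
    (hφ1 : ∀ r, HasDerivAt (φ s₀) (φ₁ r) r) (hφ2 : ∀ r, HasDerivAt φ₁ (φ₂ r) r)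
    (hU : ∀ᶠ ρ in 𝓝 ρ₀, HasDerivAt (U s₀) (u ρ) ρ) (hu : HasDerivWithinAt u L (Iio ρ₀) ρ₀) :
    u ρ₀ = φ₁ ρ₀ ∧ L ≤ φ₂ ρ₀ := by
  have hρ := (isLocalMax_slices (F := fun p : ℝ × ℝ => U p.1 p.2 - φ p.1 p.2) hmax).1
  have hg : ∀ᶠ y in 𝓝 ρ₀, HasDerivAt (fun r => U s₀ r - φ s₀ r) (u y - φ₁ y) y := by
    filter_upwards [hU] with y hy using hy.sub (hφ1 y)
  refine ⟨?_, ?_⟩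
  · have h0 := hρ.hasDerivAt_eq_zero hg.self_of_nhds
    linarith
  · have hL : HasDerivWithinAt (fun r => u r - φ₁ r) (L - φ₂ ρ₀) (Iio ρ₀) ρ₀ :=
      hu.sub (hφ2 ρ₀).hasDerivWithinAt
    have h0 := leftDeriv_deriv_nonpos_of_isLocalMax _ _ ρ₀ (L - φ₂ ρ₀) hρ hg hL
    linarith

end Summit.NavierStokesRegularity.NavierStokesRegularity.Theorems.PoloidalLiouville.NetFlux

end
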